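import Literature.AlgebraicGeometry.HodgeTheory.WeilFamilyGlobalAction
import Literature.AlgebraicGeometry.HodgeTheory.WeilClassesHodgeType
import Literature.AlgebraicGeometry.HodgeTheory.HodgeRiemannDegreeOneProofs
import Literature.AlgebraicGeometry.HodgeTheory.AlgebraicityLocusLinearSections
import Literature.AlgebraicGeometry.HodgeTheory.HyperplaneClassRational
import Literature.AlgebraicGeometry.HodgeTheory.VanishingCohomologyNontrivialProofs
import Literature.AlgebraicGeometry.HodgeTheory.PolarizationFormMonodromyInvariant
import Literature.AlgebraicGeometry.HodgeTheory.HodgeRiemannDegreeOneSigns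
import Literature.AlgebraicGeometry.HodgeTheory.DirectImageConjugation
import Literature.AlgebraicGeometry.HodgeTheory.FlatSectionNonvanishing
import Literature.AlgebraicGeometry.HodgeTheory.EigenspaceHodgeTypeCharts
import HarnessLib

/-!
# Balanced Weil type propagates along the paths of a family with a global endomorphism

Family `hodge`, layer `Literature/AlgebraicGeometry/HodgeTheory`; companion of
`WeilFamilyGlobalAction` (the named fact `deligne1982_weilFamily_globalAction`: Deligne's abelian
scheme with `K`-action, [Deligne1982HodgeCycles], proof of Thm. 4.8, p. 48). Clause (a) of that
construction — "for all `s ∈ S`, `(Y_s, ν_s)` satisfies the equivalent statements in (4.4)", i.e.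
EVERY fibre is of balanced Weil type — holds in print because the `K`-Hermitian form of the family
has constant signature on the connected base (van Geemen, LNM 1594, Lemma 5.2 (4): the signature of
`H` is `(p, q)`, the `K`-multiplicities, by Hodge–Riemann in degree one). This file PROVES that
step on the tree's real carriers, with no polarization data beyond a projective embedding of the
total space:

* `finrank_eigenspace_inf_hodgeOneZero_eq_of_path` — for `π : 𝒳 ⟶ S` with smooth projective
  fibres of dimension `d + 1` closed in one `ℙᵐ` (`ε : 𝒳 ⟶ ℙᵐ`), `R• π_* ℂ` a local system on
  `S(ℂ)`, `g` an endomorphism of `𝒳` over `S` with fibre maps `g_t` and `μ ∈ ℂ`: if the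
  `μ`-eigenspace `V_μ(s₁) ⊆ H¹(X_{s₁}(ℂ); ℂ)` of `g_{s₁}^*` has dimension `2k` and
  `dim (V_μ(s₁) ∩ H^{1,0}) = k`, then `dim (V_μ(t) ∩ H^{1,0}) = k` for every `t` joined to `s₁` by
  a path. Proof: the form `x ↦ i · Lᵈ_h (x ⌣ x̄)` (`h = ε_t^* a` the hyperplane class) is a
  positive real multiple of a rational top class `ω₀(t)` on non-zero `(1,0)`-classes and a negative
  one on non-zero `(0,1)`-classes (`hodgeRiemann_degreeOne_signs`, Voisin I Thm. 6.32); transport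
  `γ_*` along the path is injective, carries `V_μ(s₁)` into `V_μ(t)`
  (`transportFun_mem_eigenspace_fiberHom`), commutes with the pairing of the global class `ε^* a`
  (`transportFun_polarizationPairingOne`) and with conjugation (`transportFun_conjClass`), and maps
  `ω₀(s₁)` to a REAL non-zero multiple of `ω₀(t)` (both are real and the top cohomology is a line);
  hence `γ_*(V_μ(s₁) ∩ H^{1,0})`, `γ_*(V_μ(s₁) ∩ H^{0,1})` are `k`-dimensional subspaces of
  `V_μ(t)` of fixed opposite signs, each meeting the oppositely signed piece of
  `V_μ(t) = (V_μ(t) ∩ H^{1,0}) ⊕ (V_μ(t) ∩ H^{0,1})` in `0` — so both pieces have dimension `k`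
  (`finrank_eq_of_disjoint_pieces`).
* tools: `exists_isRationalClass_ne_zero_projectiveSpace`, `transportFun_lefschetzPow`,
  `transportFun_polarizationPairingOne` (transport commutes with `Q_{h,j}` for a global `h`),
  `exists_forall_isClosedImmersion_fiberι_comp` (fibres of an embedded family are closed in one `ℙᵐ`).

Consumed by `WeilFamilyKAction` (clause (a) of `deligne1982_weilFamily_globalAction` becomes a
theorem). Everything is proved; no definition and no named fact is introduced (D-0026).

## References

* [Deligne1982HodgeCycles] P. Deligne (notes by J. S. Milne), Hodge cycles on abelian varieties,
  LNM 900 (1982), Prop. 4.4, proof of Thm. 4.8 (p. 48, clause (a)).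
* [vanGeemen1994HodgeAV] B. van Geemen, An introduction to the Hodge conjecture for abelian
  varieties, LNM 1594 (1994), 4.9, Lemma 5.2 (4).
* [VoisinHodgeI2002] C. Voisin, Hodge Theory and Complex Algebraic Geometry I, CUP 2002, Thm. 6.32,
  §7.1.1–7.1.2, §9.2.1.
* [VoisinHodgeII2003] C. Voisin, Hodge Theory and Complex Algebraic Geometry II, CUP 2003, §3.1.2.
* [HatcherAT2002] A. Hatcher, Algebraic Topology, CUP 2002, Thm. 3.19.
* [Hartshorne1977] R. Hartshorne, Algebraic Geometry, GTM 52 (1977), Ch. II §4.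
-/

noncomputable section

open CategoryTheory AlgebraicGeometry Limits MonoidalCategory CartesianMonoidalCategory
open Literature.AlgebraicTopology.SingularHomology
open Literature.Geometry.Kaehler

namespace Literature.AlgebraicGeometry.HodgeTheory

/-! ### A non-zero rational generator of `H²(ℙᴺ(ℂ); ℂ)`, `N ≥ 1` -/

/-- For `N ≥ 1` there is a NON-ZERO rational class in `H²(ℙᴺ_ℂ(ℂ); ℂ)` (the group is a line,
Hatcher Thm. 3.19, and the rational classes span it, Voisin I §7.1.1).
[cite: HatcherAT2002, Thm. 3.19] [cite: VoisinHodgeI2002, §7.1.1] -/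
theorem exists_isRationalClass_ne_zero_projectiveSpace {N : ℕ} (hN : 1 ≤ N) :
    ∃ r₀ : complexBetti (Motives.projectiveSpace N ℂ) 2, IsRationalClass r₀ ∧ r₀ ≠ 0 := by
  have hP : Motives.IsSmoothProjective N (Motives.projectiveSpace N ℂ) :=
    isSmoothProjective_projectiveSpace' N
  have h1 : Module.finrank ℂ (complexBetti (Motives.projectiveSpace N ℂ) 2) = 1 :=
    finrank_complexBetti_projectiveSpace_two_mul_eq_one N (p := 1) hN
  have hspan := span_isRationalClass_eq_top_of_isSmoothProjective_holds N (Motives.projectiveSpace N ℂ) hP 2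
  by_contra hcon
  have hbot : Submodule.span ℂ {c : complexBetti (Motives.projectiveSpace N ℂ) 2 | IsRationalClass c} = ⊥ :=
    Submodule.span_eq_bot.2 fun c hc ↦ by_contra fun h0 ↦ hcon ⟨c, hc, h0⟩
  rw [hspan] at hbot
  haveI : Subsingleton (complexBetti (Motives.projectiveSpace N ℂ) 2) :=
    subsingleton_of_forall_eq 0 fun c ↦ (Submodule.mem_bot ℂ).1 (hbot ▸ Submodule.mem_top)
  rw [Module.finrank_zero_of_subsingleton] at h1
  exact zero_ne_one h1

/-! ### Transport commutes with the polarization pairing of a global class -/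

section Transport

variable {𝒳 S : Motives.SchemeOver ℂ} (π : 𝒳 ⟶ S) {U : Set (Motives.ComplexPoints S)}
  (hU : IsCohomologicallyLocallyTrivialOn π U)

/-- **Transport commutes with the iterated Lefschetz operator `Lʲ` of a GLOBAL class** `K`
(induction on `j` from `transportFun_lefschetzOperator`). [cite: VoisinHodgeII2003, §3.1.2] -/
theorem transportFun_lefschetzPow (K : complexBetti 𝒳 2) {s t : U} (γ : Path.Homotopic.Quotient s t)
    (j k : ℕ) (x : complexBetti (Motives.fiberOver π s.1) k) :
    transportFun π (k + 2 * j) hU γ (lefschetzPow (complexBetti.map (Motives.fiberι π s.1) 2 K) j k x) =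
      lefschetzPow (complexBetti.map (Motives.fiberι π t.1) 2 K) j k (transportFun π k hU γ x) := by
  induction j with
  | zero => rfl
  | succ j ih =>
    change transportFun π (k + 2 * (j + 1)) hU γ
        (lefschetzOperator (complexBetti.map (Motives.fiberι π s.1) 2 K) _
          (lefschetzPow (complexBetti.map (Motives.fiberι π s.1) 2 K) j k x)) =
      lefschetzOperator (complexBetti.map (Motives.fiberι π t.1) 2 K) _
        (lefschetzPow (complexBetti.map (Motives.fiberι π t.1) 2 K) j k (transportFun π k hU γ x))
    rw [transportFun_lefschetzOperator, ih]

/-- **Transport commutes with the polarization pairing `Q_{κ,j}(x, y) = Lʲ_κ (x ⌣ y)` of the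
restrictions `κ_s = K|_{X_s}` of a GLOBAL class** `K ∈ H²(𝒳(ℂ); ℂ)`:
`γ_* Q_{κ_s,j}(x, y) = Q_{κ_t,j}(γ_* x, γ_* y)` (transport is multiplicative and restrictions of
global classes are flat). [cite: VoisinHodgeII2003, §3.1.2] -/
theorem transportFun_polarizationPairingOne (K : complexBetti 𝒳 2) {s t : U}
    (γ : Path.Homotopic.Quotient s t) (j : ℕ) (x y : complexBetti (Motives.fiberOver π s.1) 1) :
    transportFun π (2 + 2 * j) hU γ
        (Motives.polarizationPairingOne (Motives.fiberOver π s.1)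
          (complexBetti.map (Motives.fiberι π s.1) 2 K) j x y) =
      Motives.polarizationPairingOne (Motives.fiberOver π t.1)
        (complexBetti.map (Motives.fiberι π t.1) 2 K) j (transportFun π 1 hU γ x)
        (transportFun π 1 hU γ y) := by
  rw [Motives.polarizationPairingOne_apply, Motives.polarizationPairingOne_apply,
    transportFun_lefschetzPow, transportFun_cupProduct]

end Transport

/-! ### Fibre embeddings of a projective family -/

section Embedding

variable {𝒳 S : Motives.SchemeOver ℂ} (f : 𝒳 ⟶ S)

/-- **The fibres of a projective family embed in one projective space.** For a proper family
`f : 𝒳 ⟶ S` embedded in `ℙᴺ × S` over a quasi-projective base, the total space is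
quasi-projective (`IsQuasiProjectiveOver.of_isClosedImmersion_projectiveSpace_tensor`), so it is
immersed in some `ℙᵐ`, and every fibre `𝒳_t ↪ 𝒳 → ℙᵐ` is a closed immersion
(`isClosedImmersion_fiberι_comp_left`). [cite: Hartshorne1977, Ch. II §4 (p. 103)] -/
theorem exists_forall_isClosedImmersion_fiberι_comp {n : ℕ} (hf : Motives.IsSmoothProjectiveFamily f n)
    (hemb : ∃ (N : ℕ) (ι : 𝒳 ⟶ Motives.projectiveSpace N ℂ ⊗ S),
      IsClosedImmersion ι.left ∧ ι ≫ snd (Motives.projectiveSpace N ℂ) S = f)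
    (hS : IsQuasiProjectiveOver S) :
    ∃ (m : ℕ) (ε : 𝒳 ⟶ Motives.projectiveSpace m ℂ),
      ∀ t : Motives.ComplexPoints S, IsClosedImmersion (Motives.fiberι f t ≫ ε).left := by
  obtain ⟨N, ι, hι, -⟩ := hemb
  haveI := hι
  obtain ⟨P, j, ⟨m, κ, hκ⟩, hj⟩ :=
    IsQuasiProjectiveOver.of_isClosedImmersion_projectiveSpace_tensor ι hS
  haveI := hκ
  haveI := hj
  haveI : IsPreimmersion (j ≫ κ).left := by
    rw [Over.comp_left]
    infer_instance
  haveI : IsProper f.left := hf.isProper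
  haveI : LocallyOfFiniteType S.hom := hS.locallyOfFiniteType
  exact ⟨m, j ≫ κ, fun t ↦ isClosedImmersion_fiberι_comp_left f (j ≫ κ) t⟩

end Embedding

/-! ### The top cohomology of a smooth projective `(d+1)`-fold in the degree spelling `2 + 2d` -/

/-- `dim H^{2+2d}(X(ℂ); ℂ) = 1` for `X` smooth projective of dimension `d + 1`
(`finrank_complexBetti_two_mul_eq_one` with `2 + 2d = 2(d+1)`). [cite: VoisinHodgeI2002, Thm. 6.25 and §7.1.2] -/
theorem finrank_complexBetti_two_add_two_mul_eq_one {d : ℕ} {X : Motives.SchemeOver ℂ}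
    (hX : Motives.IsSmoothProjective (d + 1) X) :
    Module.finrank ℂ (complexBetti X (2 + 2 * d)) = 1 := by
  rw [show 2 + 2 * d = 2 * (d + 1) by ring]
  exact finrank_complexBetti_two_mul_eq_one hX


/-! ### Propagation of balanced Weil type along a path -/

section Propagation

variable {𝒳 S : Motives.SchemeOver ℂ} (π : 𝒳 ⟶ S)

/-- Two real multiples of a non-zero class with opposite signs are different: if
`u = r • ω = r' • ω` with `r > 0 > r'` then `False`. [folklore] -/
theorem false_of_pos_smul_eq_neg_smul {M : Type*} [AddCommGroup M] [Module ℂ M] {ω u : M} (hω : ω ≠ 0)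
    {r r' : ℝ} (hr : 0 < r) (hr' : r' < 0) (h : u = (r : ℂ) • ω) (h' : u = (r' : ℂ) • ω) : False := by
  have hsub : ((r : ℂ) - (r' : ℂ)) • ω = 0 := by rw [sub_smul, ← h, ← h', sub_self]
  rcases smul_eq_zero.1 hsub with h0 | h0
  · have : (r : ℂ) = (r' : ℂ) := sub_eq_zero.1 h0
    have hrr : r = r' := by exact_mod_cast this
    linarith
  · exact hω h0

/-- **Balanced Weil type propagates along paths.** Let `π : 𝒳 ⟶ S` have smooth projective fibres of
dimension `d + 1`, all closed in one `ℙᵐ` through `ε : 𝒳 ⟶ ℙᵐ`, with `R• π_* ℂ` a local system on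
`S(ℂ)`; let `g` be an endomorphism of `𝒳` over `S` with fibre maps `g_t`, `μ ∈ ℂ`, and
`V_μ(t) ⊆ H¹(X_t(ℂ); ℂ)` the `μ`-eigenspace of `g_t^*`. If at `s₁` one has `dim V_μ(s₁) = 2k` and
`dim (V_μ(s₁) ∩ H^{1,0}) = k` ("balanced"), then `dim (V_μ(t) ∩ H^{1,0}) = k` at every `t` joined
to `s₁` by a path `γ`. Proof (Deligne, LNM 900, proof of Thm. 4.8, clause (a): the Hermitian form
has constant signature on the connected family; van Geemen LNM 1594 Lemma 5.2 (4)): the form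
`x ↦ i · Lᵈ_h (x ⌣ x̄)`, `h = ε^* a` the hyperplane class, is a positive real multiple of a rational
top class `ω₀` on non-zero `(1,0)`-classes and a negative one on non-zero `(0,1)`-classes
(Hodge–Riemann in degree one, `hodgeRiemann_degreeOne_signs`); transport `γ_*` along the path is
injective, maps `V_μ(s₁)` into `V_μ(t)` (`g` is global), is multiplicative, fixes the restrictions
of the global class `ε^* a`, commutes with conjugation and maps `ω₀(s₁)` to a REAL non-zero
multiple `c ω₀(t)`; so `γ_*(V_μ(s₁) ∩ H^{1,0})` and `γ_*(V_μ(s₁) ∩ H^{0,1})` are `k`-dimensional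
subspaces of `V_μ(t)` on which the form has a fixed sign, each meeting the oppositely signed piece of
`V_μ(t) = (V_μ(t) ∩ H^{1,0}) ⊕ (V_μ(t) ∩ H^{0,1})` trivially, whence both pieces have dimension
`≤ k`, i.e. `= k`. [cite: Deligne1982HodgeCycles, proof of Thm. 4.8 (a) with Prop. 4.4]
[cite: vanGeemen1994HodgeAV, Lemma 5.2 (4)] [cite: VoisinHodgeI2002, Thm. 6.32 and §9.2.1] -/
theorem finrank_eigenspace_inf_hodgeOneZero_eq_of_path {d k m : ℕ}
    (hsp : ∀ t : Motives.ComplexPoints S, Motives.IsSmoothProjective (d + 1) (Motives.fiberOver π t))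
    (hU : IsCohomologicallyLocallyTrivialOn π (Set.univ : Set (Motives.ComplexPoints S)))
    (g : 𝒳 ⟶ 𝒳) (hg : g ≫ π = π)
    (gf : ∀ t : Motives.ComplexPoints S, Motives.fiberOver π t ⟶ Motives.fiberOver π t)
    (hgf : ∀ t, gf t ≫ Motives.fiberι π t = Motives.fiberι π t ≫ g) (μ : ℂ)
    (ε : 𝒳 ⟶ Motives.projectiveSpace m ℂ)
    (hε : ∀ t : Motives.ComplexPoints S, IsClosedImmersion (Motives.fiberι π t ≫ ε).left)
    {s₁ t : Motives.ComplexPoints S}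
    (γ : Path.Homotopic.Quotient (⟨s₁, Set.mem_univ s₁⟩ : (Set.univ : Set (Motives.ComplexPoints S)))
      ⟨t, Set.mem_univ t⟩)
    (hE : Module.finrank ℂ ↥(Module.End.eigenspace (complexBetti.map (gf s₁) 1).hom μ) = 2 * k)
    (hbal : Module.finrank ℂ ↥(Module.End.eigenspace (complexBetti.map (gf s₁) 1).hom μ ⊓
      hodgeOneZero (hsp s₁)) = k) :
    Module.finrank ℂ ↥(Module.End.eigenspace (complexBetti.map (gf t) 1).hom μ ⊓
      hodgeOneZero (hsp t)) = k := by
  classical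
  haveI := finite_complexBetti (hsp s₁) 1
  haveI := finite_complexBetti (hsp t) 1
  haveI : IsClosedImmersion (Motives.fiberι π s₁ ≫ ε).left := hε s₁
  haveI : IsClosedImmersion (Motives.fiberι π t ≫ ε).left := hε t
  -- the pieces
  set E₁ := Module.End.eigenspace (complexBetti.map (gf s₁) 1).hom μ with hE₁def
  set E₂ := Module.End.eigenspace (complexBetti.map (gf t) 1).hom μ with hE₂def
  set P₁ := E₁ ⊓ hodgeOneZero (hsp s₁) with hP₁def
  set N₁ := E₁ ⊓ hodgeZeroOne (hsp s₁) with hN₁def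
  set P₂ := E₂ ⊓ hodgeOneZero (hsp t) with hP₂def
  set N₂ := E₂ ⊓ hodgeZeroOne (hsp t) with hN₂def
  -- the transports
  let T := transportLinear π 1 hU γ
  have hTinj : Function.Injective T := transportFun_injective π 1 hU γ
  have hTE : ∀ v ∈ E₁, T v ∈ E₂ := fun v hv ↦
    transportFun_mem_eigenspace_fiberHom π 1 hU g hg gf hgf γ hv
  let T' := transportLinear π 1 hU γ.symm
  have hT'inj : Function.Injective T' := transportFun_injective π 1 hU γ.symm
  have hT'E : ∀ v ∈ E₂, T' v ∈ E₁ := fun v hv ↦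
    transportFun_mem_eigenspace_fiberHom π 1 hU g hg gf hgf γ.symm hv
  -- dimension counts: `dim N₁ = k`, `dim E₂ = 2k`, `dim P₂ + dim N₂ = 2k`
  have hsum₁ := finrank_eigenspace_eq_add (hsp s₁) (gf s₁) μ
  have hN₁ : Module.finrank ℂ N₁ = k := by
    rw [← hE₁def, hE, ← hP₁def, hbal, ← hN₁def] at hsum₁
    omega
  have hmapE₁ : E₁.map T ≤ E₂ := Submodule.map_le_iff_le_comap.2 fun v hv ↦ hTE v hv
  have hmapE₂ : E₂.map T' ≤ E₁ := Submodule.map_le_iff_le_comap.2 fun v hv ↦ hT'E v hv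
  have hE₂ : Module.finrank ℂ E₂ = 2 * k := by
    apply le_antisymm
    · have h := Submodule.finrank_mono hmapE₂
      rw [LinearEquiv.finrank_eq (Submodule.equivMapOfInjective T' hT'inj E₂).symm, hE] at h
      exact h
    · have h := Submodule.finrank_mono hmapE₁
      rw [LinearEquiv.finrank_eq (Submodule.equivMapOfInjective T hTinj E₁).symm, hE] at h
      exact h
  have hsum₂ : Module.finrank ℂ P₂ + Module.finrank ℂ N₂ = 2 * k := by
    rw [← hE₂, hP₂def, hN₂def, hE₂def]
    exact (finrank_eigenspace_eq_add (hsp t) (gf t) μ).symm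
  -- the images of the pieces at `s₁`
  have hW₁ : P₁.map T ≤ E₂ := (Submodule.map_mono inf_le_left).trans hmapE₁
  have hW₂ : N₁.map T ≤ E₂ := (Submodule.map_mono inf_le_left).trans hmapE₁
  have hfW₁ : Module.finrank ℂ ↥(P₁.map T) = k := by
    rw [← LinearEquiv.finrank_eq (Submodule.equivMapOfInjective T hTinj P₁), hP₁def, hE₁def, hbal]
  have hfW₂ : Module.finrank ℂ ↥(N₁.map T) = k := by
    rw [← LinearEquiv.finrank_eq (Submodule.equivMapOfInjective T hTinj N₁), hN₁]
  -- the hyperplane class: `m ≥ 1`, a non-zero rational `a ∈ H²(ℙᵐ)`, `K = ε^* a`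
  have hm : 1 ≤ m :=
    le_trans (Nat.le_add_left 1 d) (le_of_isClosedImmersion_projectiveSpace (hsp t) (Motives.fiberι π t ≫ ε))
  obtain ⟨a, ha, ha0⟩ := exists_isRationalClass_ne_zero_projectiveSpace hm
  let emb₁ : Motives.ProjectiveEmbedding (Motives.fiberOver π s₁) := ⟨m, Motives.fiberι π s₁ ≫ ε, hε s₁⟩
  let emb₂ : Motives.ProjectiveEmbedding (Motives.fiberOver π t) := ⟨m, Motives.fiberι π t ≫ ε, hε t⟩
  set K : complexBetti 𝒳 2 := complexBetti.map ε 2 a with hKdef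
  have hK₁ : complexBetti.map emb₁.ι 2 a = complexBetti.map (Motives.fiberι π s₁) 2 K := by
    change complexBetti.map (Motives.fiberι π s₁ ≫ ε) 2 a = _
    rw [complexBetti.map_comp, ModuleCat.comp_apply]
  have hK₂ : complexBetti.map emb₂.ι 2 a = complexBetti.map (Motives.fiberι π t) 2 K := by
    change complexBetti.map (Motives.fiberι π t ≫ ε) 2 a = _
    rw [complexBetti.map_comp, ModuleCat.comp_apply]
  -- Hodge–Riemann signs at `s₁` and at `t`
  obtain ⟨ω₁, hω₁r, hω₁0, hpos₁, hneg₁⟩ := hodgeRiemann_degreeOne_signs (hsp s₁) emb₁ ha ha0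
  obtain ⟨ω₂, hω₂r, hω₂0, hpos₂, hneg₂⟩ := hodgeRiemann_degreeOne_signs (hsp t) emb₂ ha ha0
  rw [hK₁] at hpos₁ hneg₁
  rw [hK₂] at hpos₂ hneg₂
  -- transport of the top class: `γ_* ω₁ = c ω₂`, `c` real and non-zero
  haveI : Module.Finite ℂ (complexBetti (Motives.fiberOver π t) (2 + 2 * d)) :=
    Module.finite_of_finrank_eq_succ (finrank_complexBetti_two_add_two_mul_eq_one (hsp t))
  have hline : ∀ w : complexBetti (Motives.fiberOver π t) (2 + 2 * d), ∃ c : ℂ, c • ω₂ = w :=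
    (finrank_eq_one_iff_of_nonzero' (K := ℂ) ω₂ hω₂0).1 (finrank_complexBetti_two_add_two_mul_eq_one (hsp t))
  obtain ⟨c, hc⟩ : ∃ c : ℂ, transportFun π (2 + 2 * d) hU γ ω₁ = c • ω₂ := by
    obtain ⟨c, hc⟩ := hline (transportFun π (2 + 2 * d) hU γ ω₁ :)
    exact ⟨c, hc.symm⟩
  have hcim : c.im = 0 := by
    refine im_eq_zero_of_smul_eq_of_conjClass_eq ?_ hω₂r.conjClass_eq hω₂0 hc
    have h := transportFun_conjClass π (2 + 2 * d) hU γ ω₁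
    rw [hω₁r.conjClass_eq] at h
    exact h.symm
  have hc0 : c ≠ 0 := by
    rintro rfl
    rw [zero_smul] at hc
    have h0 : transportFun π (2 + 2 * d) hU γ ω₁ = transportFun π (2 + 2 * d) hU γ 0 := by
      rw [hc, ← transportLinear_apply, map_zero]
    exact hω₁0 (transportFun_injective π (2 + 2 * d) hU γ h0)
  have hcre : c = (c.re : ℂ) := Complex.ext rfl (by rw [hcim, Complex.ofReal_im])
  -- transport of the Hodge–Riemann form: `i Q_t(γ_* x, conj γ_* x) = γ_* (i Q_{s₁}(x, x̄))`
  have key : ∀ (x : complexBetti (Motives.fiberOver π s₁) 1) (r : ℝ),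
      Complex.I • Motives.polarizationPairingOne (Motives.fiberOver π s₁)
        (complexBetti.map (Motives.fiberι π s₁) 2 K) d x
          (conjClass (Motives.ComplexPoints (Motives.fiberOver π s₁)) 1 x) = (r : ℂ) • ω₁ →
      Complex.I • Motives.polarizationPairingOne (Motives.fiberOver π t)
        (complexBetti.map (Motives.fiberι π t) 2 K) d (T x :)
          (conjClass (Motives.ComplexPoints (Motives.fiberOver π t)) 1 (T x :)) = ((r * c.re : ℝ) : ℂ) • ω₂ := by
    intro x r hx
    have h := congrArg (transportFun π (2 + 2 * d) hU γ) hx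
    rw [transportFun_smul, transportFun_smul, transportFun_polarizationPairingOne π hU K γ d,
      transportFun_conjClass π 1 hU γ, hc, smul_smul] at h
    rw [show (((r * c.re : ℝ) : ℂ)) = (r : ℂ) * c by rw [Complex.ofReal_mul, ← hcre]]
    exact h
  -- sign predicates at `t`
  have hexcl : ∀ v : complexBetti (Motives.fiberOver π t) 1,
      (∃ r : ℝ, 0 < r ∧ Complex.I • Motives.polarizationPairingOne (Motives.fiberOver π t)
        (complexBetti.map (Motives.fiberι π t) 2 K) d v
          (conjClass (Motives.ComplexPoints (Motives.fiberOver π t)) 1 v) = (r : ℂ) • ω₂) →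
      (∃ r : ℝ, r < 0 ∧ Complex.I • Motives.polarizationPairingOne (Motives.fiberOver π t)
        (complexBetti.map (Motives.fiberι π t) 2 K) d v
          (conjClass (Motives.ComplexPoints (Motives.fiberOver π t)) 1 v) = (r : ℂ) • ω₂) → False := by
    rintro v ⟨r, hr, h⟩ ⟨r', hr', h'⟩
    exact false_of_pos_smul_eq_neg_smul hω₂0 hr hr' h h'
  have hP₂sign : ∀ v ∈ P₂, v ≠ 0 → ∃ r : ℝ, 0 < r ∧
      Complex.I • Motives.polarizationPairingOne (Motives.fiberOver π t)
        (complexBetti.map (Motives.fiberι π t) 2 K) d v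
          (conjClass (Motives.ComplexPoints (Motives.fiberOver π t)) 1 v) = (r : ℂ) • ω₂ :=
    fun v hv hv0 ↦ hpos₂ v hv.2 hv0
  have hN₂sign : ∀ v ∈ N₂, v ≠ 0 → ∃ r : ℝ, r < 0 ∧
      Complex.I • Motives.polarizationPairingOne (Motives.fiberOver π t)
        (complexBetti.map (Motives.fiberι π t) 2 K) d v
          (conjClass (Motives.ComplexPoints (Motives.fiberOver π t)) 1 v) = (r : ℂ) • ω₂ :=
    fun v hv hv0 ↦ hneg₂ v hv.2 hv0
  -- signs on the transported pieces, according to the sign of `c`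
  have hTP₁ : ∀ v ∈ P₁.map T, v ≠ 0 → ∃ r : ℝ, 0 < r ∧
      Complex.I • Motives.polarizationPairingOne (Motives.fiberOver π t)
        (complexBetti.map (Motives.fiberι π t) 2 K) d v
          (conjClass (Motives.ComplexPoints (Motives.fiberOver π t)) 1 v) = ((r * c.re : ℝ) : ℂ) • ω₂ := by
    rintro v ⟨x, hx, rfl⟩ hv0
    have hx0 : x ≠ 0 := by rintro rfl; exact hv0 (map_zero T)
    obtain ⟨r, hr, h⟩ := hpos₁ x hx.2 hx0
    exact ⟨r, hr, key x r h⟩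
  have hTN₁ : ∀ v ∈ N₁.map T, v ≠ 0 → ∃ r : ℝ, r < 0 ∧
      Complex.I • Motives.polarizationPairingOne (Motives.fiberOver π t)
        (complexBetti.map (Motives.fiberι π t) 2 K) d v
          (conjClass (Motives.ComplexPoints (Motives.fiberOver π t)) 1 v) = ((r * c.re : ℝ) : ℂ) • ω₂ := by
    rintro v ⟨x, hx, rfl⟩ hv0
    have hx0 : x ≠ 0 := by rintro rfl; exact hv0 (map_zero T)
    obtain ⟨r, hr, h⟩ := hneg₁ x hx.2 hx0
    exact ⟨r, hr, key x r h⟩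
  -- disjointness
  have hdis : (P₁.map T ⊓ N₂ = ⊥ ∧ N₁.map T ⊓ P₂ = ⊥) ∨ (P₁.map T ⊓ P₂ = ⊥ ∧ N₁.map T ⊓ N₂ = ⊥) := by
    rcases lt_or_gt_of_ne (show c.re ≠ 0 from fun h ↦ hc0 (by rw [hcre, h, Complex.ofReal_zero])) with hneg | hpos
    · right
      constructor
      · rw [eq_bot_iff]
        intro v hv
        rw [Submodule.mem_bot]
        by_contra hv0
        obtain ⟨r, hr, h⟩ := hTP₁ v hv.1 hv0
        exact hexcl v (hP₂sign v hv.2 hv0) ⟨r * c.re, mul_neg_of_pos_of_neg hr hneg, h⟩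
      · rw [eq_bot_iff]
        intro v hv
        rw [Submodule.mem_bot]
        by_contra hv0
        obtain ⟨r, hr, h⟩ := hTN₁ v hv.1 hv0
        exact hexcl v ⟨r * c.re, mul_pos_of_neg_of_neg hr hneg, h⟩ (hN₂sign v hv.2 hv0)
    · left
      constructor
      · rw [eq_bot_iff]
        intro v hv
        rw [Submodule.mem_bot]
        by_contra hv0
        obtain ⟨r, hr, h⟩ := hTP₁ v hv.1 hv0
        exact hexcl v ⟨r * c.re, mul_pos hr hpos, h⟩ (hN₂sign v hv.2 hv0)
      · rw [eq_bot_iff]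
        intro v hv
        rw [Submodule.mem_bot]
        by_contra hv0
        obtain ⟨r, hr, h⟩ := hTN₁ v hv.1 hv0
        exact hexcl v (hP₂sign v hv.2 hv0) ⟨r * c.re, mul_neg_of_neg_of_pos hr hpos, h⟩
  -- count
  haveI : Module.Finite ℂ E₂ := inferInstance
  exact finrank_eq_of_disjoint_pieces (E := E₂) (A := P₂) (B := N₂) (W₁ := P₁.map T) (W₂ := N₁.map T)
    hE₂ inf_le_left inf_le_left hW₁ hW₂ hsum₂ hfW₁ hfW₂ hdis

end Propagation

end Literature.AlgebraicGeometry.HodgeTheory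

end
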